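import Summits.KontsevichZagierPeriods.KontsevichZagierPeriods.Theses.K2SymbolChains
import Summits.KontsevichZagierPeriods.KontsevichZagierPeriods.Theorems.K2SymbolChainsJensenIsScissorsCases
import Summits.KontsevichZagierPeriods.KontsevichZagierPeriods.Theorems.K2SymbolChainsJensenIsScissorsRotation
import Summits.KontsevichZagierPeriods.KontsevichZagierPeriods.Theorems.K2SymbolChainsJensenMoveGlue

/-!
# `JensenMoveDisc` (stmt-KontsevichZagierPeriods-17759, route K2SymbolChains) — proof

`JensenMoveDisc` — JENSEN ON THE PUNCTURED CLOSED DISC, SMOOTH CENTRE (split child 1 of the crux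
`JensenMove`): over a `ℚ`-semialgebraic base `τ ⊆ ℝⁿ` with semialgebraic weight `h` and centre
`α = α₁ + iα₂`, differentiable on `τ` with `0 < |α|² ≤ 1` there, and `h (1 + |log|α|²|) ∈ L¹(τ)`,
the unfolded torus representation `r` of `∫_τ h · J(α)`, `J(α) = ∫₀^{2π} log|e^{iφ} − α| dφ`
(coordinates `(x, s, u)`, `e(s) = ((1 − s²) + 2is)/(1 + s²)`, `u` between `1` and
`W_α = |e(s) − α(x)|²`, integrand `±h(x)/((1 + s²)u)`) satisfies `[r] ∈ KZ.relations`
(Jensen: `J(α) = 2π log⁺|α| = 0`).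

Proof (the crux-strategist's sorry-free line `Cruxes/JensenMove/Lines/jensen_move_complete.lean`,
disc part, re-homed under `Theorems/` by lead c10 of crux stmt-KontsevichZagierPeriods-9129,
banking; everything for an arbitrary subgroup `S ⊇ (1a) ∪ (1b) ∪ (2)`):
* `rotate_normal_form` — the item's coordinates ARE the signed unfolding
  `KZ.logUnfoldDomain {b | init b ∈ B} W_α` with integrand `KZ.logUnfoldIntegrand (h/(1 + s²))`
  (bridge `rfl` + `a·b/(c·d) = a·(b/c)/d`); then the landed `rotation_step` (`W_α → W_ρ`,
  `ρ = |α|`, rule 2 by the rational rotation of the circle);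
* `weights` — `h ∈ L¹(B)` and `h · log ρ ∈ L¹(B)` from `h (1 + |log|α|²|) ∈ L¹(B)` (bounded
  measurable multipliers, Tarski–Seidenberg measurability);
* `jensenMoveDisc_mem` — cut the base into `{|α| < 1} ∪ {|α| = 1}` (rule 1a; the remainder is
  empty), rotate, and apply the landed `jensen_inside` (doubling + radial constancy, `0 < ρ < 1`)
  and `jensen_circle` (doubling alone, `ρ = 1`; the weight hypothesis gives `h ∈ L¹` on the circle
  regime, which is all `jensen_circle` needs) of `Theorems/K2SymbolChainsJensenIsScissorsCases.lean`.
[Jensen 1899; Kontsevich–Zagier 2001, §1.2, rules 1)–2)] [folklore]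
-/

noncomputable section

open MeasureTheory Set
open Literature.NumberTheory.Transcendental Literature.ModelTheory.ExponentialFields

namespace Summit.KontsevichZagierPeriods.K2SymbolChains

namespace JensenMoveDiscProof

open Literature.NumberTheory.Transcendental.KZ
open Summit.KontsevichZagierPeriods.K2SymbolChains.JensenIsScissorsProof
open Summit.KontsevichZagierPeriods.K2SymbolChains.JensenMoveSplitGlue

/-- **A weight lemma**: if `F` is integrable on a measurable `B` and `m` is measurable with
`|m| ≤ C`, then `m · F` is integrable on `B`. [folklore] -/
theorem integrableOn_measurable_bdd_mul {n : ℕ} {B : Set (Fin n → ℝ)} {F m : (Fin n → ℝ) → ℝ}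
    (hF : IntegrableOn F B) (hm : Measurable m) {C : ℝ} (hC : ∀ x, |m x| ≤ C) :
    IntegrableOn (fun x => m x * F x) B :=
  Integrable.bdd_mul hF hm.aestronglyMeasurable (Filter.Eventually.of_forall fun x => by
    simpa [Real.norm_eq_abs] using hC x)

/-- **Rotation to the real-centre normal form**: the item's domain and integrand are
the signed unfolding over `{b | init b ∈ B}` of `h/(1+s²) · log W_α` (coordinate bridge, `rfl` up to
`(h/(1+s²))/u = h/((1+s²)u)`), and the landed `rotation_step` carries `W_α` to `W_ρ`.
[Kontsevich–Zagier 2001, §1.2, rule 2)] [folklore] -/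
theorem rotate_normal_form {S : AddSubgroup Literature.NumberTheory.Transcendental.KZ.FormalRep} (hS : Literature.NumberTheory.Transcendental.KZ.domainAddRel ∪ Literature.NumberTheory.Transcendental.KZ.integrandAddRel ∪ Literature.NumberTheory.Transcendental.KZ.changeOfVariablesRel ⊆ S) : ∀ (n : ℕ) (B : Set (Fin n → ℝ)) (h α₁ α₂ : (Fin n → ℝ) → ℝ) (r : Literature.NumberTheory.Transcendental.KZ.IntegralRep (n + 2)), Literature.ModelTheory.ExponentialFields.IsSemialgebraic ℚ B → Literature.NumberTheory.Transcendental.IsSemialgebraicFunOn ℚ B h → Literature.NumberTheory.Transcendental.IsSemialgebraicFunOn ℚ B α₁ → Literature.NumberTheory.Transcendental.IsSemialgebraicFunOn ℚ B α₂ → (∀ x ∈ B, DifferentiableAt ℝ α₁ x ∧ DifferentiableAt ℝ α₂ x) → (∀ x ∈ B, α₁ x ^ 2 + α₂ x ^ 2 ≠ 0) → r.domain = {w | (fun i : Fin n => w (Fin.castAdd 2 i)) ∈ B ∧ ((1 < w (Fin.natAdd n 1) ∧ w (Fin.natAdd n 1) < (((1 - w (Fin.natAdd n 0) ^ 2) /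 (1 + w (Fin.natAdd n 0) ^ 2) - α₁ (fun i : Fin n => w (Fin.castAdd 2 i))) ^ 2 + (2 * w (Fin.natAdd n 0) / (1 + w (Fin.natAdd n 0) ^ 2) - α₂ (fun i : Fin n => w (Fin.castAdd 2 i))) ^ 2)) ∨ ((((1 - w (Fin.natAdd n 0) ^ 2) / (1 + w (Fin.natAdd n 0) ^ 2) - α₁ (fun i : Fin n => w (Fin.castAdd 2 i))) ^ 2 + (2 * w (Fin.natAdd n 0) / (1 + w (Fin.natAdd n 0) ^ 2) - α₂ (fun i : Fin n => w (Fin.castAdd 2 i))) ^ 2) < w (Fin.natAdd n 1) ∧ w (Fin.natAdd n 1) < 1))} → (∀ w ∈ r.domain, r.integrand w = (if 1 < w (Fin.natAdd n 1) then (1:ℝ) else -1) * h (fun i : Fin n => w (Fin.castAdd 2 i)) / ((1 + w (Fin.natAdd n 0) ^ 2) * w (Fin.natAdd n 1))) → ∃ R' : Literature.NumberTheory.Transcendental.KZ.IntegralRep (n + 1 + 1), R'.domain = Literature.NumberTheory.Transcendental.KZ.logUnfoldDomain {b : Fin (n + 1) → ℝ | Fin.init b ∈ B} (fun b => ((1 -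 Real.sqrt (α₁ (Fin.init b) ^ 2 + α₂ (Fin.init b) ^ 2)) ^ 2 + (1 + Real.sqrt (α₁ (Fin.init b) ^ 2 + α₂ (Fin.init b) ^ 2)) ^ 2 * b (Fin.last n) ^ 2) / (1 + b (Fin.last n) ^ 2)) ∧ R'.integrand = Literature.NumberTheory.Transcendental.KZ.logUnfoldIntegrand (fun b => h (Fin.init b) / (1 + b (Fin.last n) ^ 2)) ∧ Literature.NumberTheory.Transcendental.KZ.of r - Literature.NumberTheory.Transcendental.KZ.of R' ∈ S := by
  intro n B h α₁ α₂ r hB hh hα₁ hα₂ hdiff hne hrd hri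
  have hrd' : r.domain = logUnfoldDomain {b : Fin (n + 1) → ℝ | Fin.init b ∈ B}
      (fun b => ((1 - b (Fin.last n) ^ 2) / (1 + b (Fin.last n) ^ 2) - α₁ (Fin.init b)) ^ 2 +
        (2 * b (Fin.last n) / (1 + b (Fin.last n) ^ 2) - α₂ (Fin.init b)) ^ 2) := by
    rw [hrd]; rfl
  have hri' : EqOn r.integrand
      (logUnfoldIntegrand fun b => h (Fin.init b) / (1 + b (Fin.last n) ^ 2)) r.domain := by
    intro w hw
    rw [hri w hw]
    show (if 1 < w (Fin.natAdd n 1) then (1:ℝ) else -1) * h (fun i : Fin n => w (Fin.castAdd 2 i)) /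
        ((1 + w (Fin.natAdd n 0) ^ 2) * w (Fin.natAdd n 1)) =
      (if 1 < w (Fin.natAdd n 1) then (1:ℝ) else -1) *
        (h (fun i : Fin n => w (Fin.castAdd 2 i)) / (1 + w (Fin.natAdd n 0) ^ 2)) / w (Fin.natAdd n 1)
    rw [mul_div_assoc, mul_div_assoc, div_div]
  exact rotation_step hS hB hh hα₁ hα₂ hne (fun x hx => (hdiff x hx).1) (fun x hx => (hdiff x hx).2) r
    hrd' hri'

/-- **Weights**: `h = F · (1 + |log|α|²|)⁻¹` and
`h · log ρ = F · (log|α|²/2)(1 + |log|α|²|)⁻¹` with `F = h(1 + |log|α|²|) ∈ L¹(B)` and bounded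
measurable multipliers (Tarski–Seidenberg measurability of semialgebraic functions). [folklore] -/
theorem weights : ∀ (n : ℕ) (B : Set (Fin n → ℝ)) (h α₁ α₂ : (Fin n → ℝ) → ℝ), Literature.ModelTheory.ExponentialFields.IsSemialgebraic ℚ B → Literature.NumberTheory.Transcendental.IsSemialgebraicFunOn ℚ B h → Literature.NumberTheory.Transcendental.IsSemialgebraicFunOn ℚ B α₁ → Literature.NumberTheory.Transcendental.IsSemialgebraicFunOn ℚ B α₂ → MeasureTheory.IntegrableOn (fun x => h x * (1 + |Real.log (α₁ x ^ 2 + α₂ x ^ 2)|)) B → MeasureTheory.IntegrableOn h B ∧ MeasureTheory.IntegrableOn (fun x => h x * Real.log (Real.sqrt (α₁ x ^ 2 + α₂ x ^ 2))) B := by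
  intro n B h α₁ α₂ hB hh hα₁ hα₂ hint
  have hBm : MeasurableSet B := IsSemialgebraic.measurableSet_holds hB
  set ρ2 : (Fin n → ℝ) → ℝ := fun x => α₁ x ^ 2 + α₂ x ^ 2 with hρ2_def
  have hρ2 : IsSemialgebraicFunOn ℚ B ρ2 :=
    (IsSemialgebraicFunOn.add_holds (IsSemialgebraicFunOn.mul_holds hα₁ hα₁)
      (IsSemialgebraicFunOn.mul_holds hα₂ hα₂)).congr fun x _ => by
      simp only [hρ2_def, Pi.add_apply, Pi.mul_apply]; ring
  have hρ2_nonneg : ∀ x, 0 ≤ ρ2 x := fun x => by simp only [hρ2_def]; positivity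
  -- a measurable version of `ρ2` agreeing with it on `B`
  set V : (Fin n → ℝ) → ℝ := B.indicator ρ2 with hV_def
  have hVm : Measurable V := hρ2.measurable_indicator_of_tarskiSeidenberg tarski_seidenberg_real_holds hBm
  have hVB : ∀ x ∈ B, V x = ρ2 x := fun x hx => by simp [hV_def, indicator_of_mem hx]
  have hL : Measurable fun x => Real.log (V x) := Real.measurable_log.comp hVm
  -- the two bounded multipliers
  set m₁ : (Fin n → ℝ) → ℝ := fun x => (1 + |Real.log (V x)|)⁻¹ with hm₁_def
  set m₂ : (Fin n → ℝ) → ℝ := fun x => Real.log (V x) / 2 * (1 + |Real.log (V x)|)⁻¹ with hm₂_def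
  have hm₁ : Measurable m₁ := (measurable_const.add hL.abs).inv
  have hm₂ : Measurable m₂ := (hL.div_const 2).mul (measurable_const.add hL.abs).inv
  have hpos : ∀ x, 0 < 1 + |Real.log (V x)| := fun x => by positivity
  have hb₁ : ∀ x, |m₁ x| ≤ 1 := fun x => by
    have h1 : 1 ≤ 1 + |Real.log (V x)| := by linarith [abs_nonneg (Real.log (V x))]
    rw [hm₁_def, abs_inv, abs_of_pos (hpos x)]
    exact inv_le_one_of_one_le₀ h1
  have hb₂ : ∀ x, |m₂ x| ≤ 1 := fun x => by
    have ha := abs_nonneg (Real.log (V x))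
    show |Real.log (V x) / 2 * (1 + |Real.log (V x)|)⁻¹| ≤ 1
    rw [abs_mul, abs_inv, abs_of_pos (hpos x), abs_div, abs_two, ← div_eq_mul_inv,
      div_le_one (hpos x)]
    linarith
  have e₁ := integrableOn_measurable_bdd_mul hint hm₁ hb₁
  have e₂ := integrableOn_measurable_bdd_mul hint hm₂ hb₂
  constructor
  · refine e₁.congr_fun (fun x hx => ?_) hBm
    have hne : (1 + |Real.log (α₁ x ^ 2 + α₂ x ^ 2)| : ℝ) ≠ 0 := by positivity
    simp only [hm₁_def, hVB x hx, hρ2_def]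
    field_simp
  · refine e₂.congr_fun (fun x hx => ?_) hBm
    have hne : (1 + |Real.log (α₁ x ^ 2 + α₂ x ^ 2)| : ℝ) ≠ 0 := by positivity
    have h0 : 0 ≤ α₁ x ^ 2 + α₂ x ^ 2 := by positivity
    simp only [hm₂_def, hVB x hx, hρ2_def]
    rw [Real.log_sqrt h0]
    field_simp

/-- **Jensen on the punctured closed disc, smooth centre** (the statement of route item
`K2SymbolChains.JensenMoveDisc`, spelled out). [Jensen 1899; Kontsevich–Zagier 2001, §1.2] [folklore] -/
theorem jensenMoveDisc_mem {S : AddSubgroup Literature.NumberTheory.Transcendental.KZ.FormalRep} (hS : Literature.NumberTheory.Transcendental.KZ.domainAddRel ∪ Literature.NumberTheory.Transcendental.KZ.integrandAddRel ∪ Literature.NumberTheory.Transcendental.KZ.changeOfVariablesRel ⊆ S) :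
    ∀ (n : ℕ) (τ : Set (Fin n → ℝ)) (h α₁ α₂ : (Fin n → ℝ) → ℝ) (r : Literature.NumberTheory.Transcendental.KZ.IntegralRep (n + 2)), Literature.ModelTheory.ExponentialFields.IsSemialgebraic ℚ τ → Literature.NumberTheory.Transcendental.IsSemialgebraicFunOn ℚ τ h → Literature.NumberTheory.Transcendental.IsSemialgebraicFunOn ℚ τ α₁ → Literature.NumberTheory.Transcendental.IsSemialgebraicFunOn ℚ τ α₂ → (∀ x ∈ τ, DifferentiableAt ℝ α₁ x ∧ DifferentiableAt ℝ α₂ x) → (∀ x ∈ τ, 0 < α₁ x ^ 2 + α₂ x ^ 2 ∧ α₁ x ^ 2 + α₂ x ^ 2 ≤ 1) → MeasureTheory.IntegrableOn (fun x => h x * (1 + |Real.log (α₁ x ^ 2 + α₂ x ^ 2)|)) τ → r.domain = {w | (fun i : Fin n => w (Fin.castAdd 2 i)) ∈ τ ∧ ((1 < w (Fin.natAdd n 1) ∧ w (Fin.natAdd n 1) < (((1 - w (Fin.natAdd n 0) ^ 2) / (1 + w (Fin.natAdd n 0) ^ 2) - α₁ (fun i : Fin n => w (Fin.castAdd 2 i)))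 ^ 2 + (2 * w (Fin.natAdd n 0) / (1 + w (Fin.natAdd n 0) ^ 2) - α₂ (fun i : Fin n => w (Fin.castAdd 2 i))) ^ 2)) ∨ ((((1 - w (Fin.natAdd n 0) ^ 2) / (1 + w (Fin.natAdd n 0) ^ 2) - α₁ (fun i : Fin n => w (Fin.castAdd 2 i))) ^ 2 + (2 * w (Fin.natAdd n 0) / (1 + w (Fin.natAdd n 0) ^ 2) - α₂ (fun i : Fin n => w (Fin.castAdd 2 i))) ^ 2) < w (Fin.natAdd n 1) ∧ w (Fin.natAdd n 1) < 1))} → (∀ w ∈ r.domain, r.integrand w = (if 1 < w (Fin.natAdd n 1) then (1:ℝ) else -1) * h (fun i : Fin n => w (Fin.castAdd 2 i)) / ((1 + w (Fin.natAdd n 0) ^ 2) * w (Fin.natAdd n 1))) → Literature.NumberTheory.Transcendental.KZ.of r ∈ S := by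
  have hrot := rotate_normal_form hS
  have hw := @weights
  intro n τ h α₁ α₂ r hτ hh hα₁ hα₂ hdiff hreg hint hrd hri
  -- the regimes `|α| < 1` (`Tl`) and `|α| = 1` (`Te`)
  set ρ2 : (Fin n → ℝ) → ℝ := fun x => α₁ x ^ 2 + α₂ x ^ 2 with hρ2_def
  have hρ2 : IsSemialgebraicFunOn ℚ τ ρ2 :=
    (IsSemialgebraicFunOn.add_holds (IsSemialgebraicFunOn.mul_holds hα₁ hα₁)
      (IsSemialgebraicFunOn.mul_holds hα₂ hα₂)).congr fun x _ => by
      simp only [hρ2_def, Pi.add_apply, Pi.mul_apply]; ring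
  set g : (Fin n → ℝ) → ℝ := fun x => ρ2 x - 1 with hg_def
  have hg : IsSemialgebraicFunOn ℚ τ g :=
    (IsSemialgebraicFunOn.sub_holds hρ2 (isSemialgebraicFunOn_ratCast hτ 1)).congr fun x _ => by
      simp [hg_def]
  set Tl : Set (Fin n → ℝ) := {x | x ∈ τ ∧ g x < 0} with hTl_def
  set Te : Set (Fin n → ℝ) := {x | x ∈ τ ∧ g x = 0} with hTe_def
  have hTl : IsSemialgebraic ℚ Tl := hg.isSemialgebraic_sep_neg
  have hTe : IsSemialgebraic ℚ Te := hg.isSemialgebraic_sep_eq_zero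
  have hTlτ : Tl ⊆ τ := fun x hx => hx.1
  have hTeτ : Te ⊆ τ := fun x hx => hx.1
  -- the modulus
  set ρ : (Fin n → ℝ) → ℝ := fun x => Real.sqrt (α₁ x ^ 2 + α₂ x ^ 2) with hρ_def
  have hρs : ∀ {B : Set (Fin n → ℝ)}, B ⊆ τ → IsSemialgebraic ℚ B → IsSemialgebraicFunOn ℚ B ρ :=
    fun hB hBs => isSemialgebraicFunOn_modulus (hα₁.mono hB hBs) (hα₂.mono hB hBs)
  have hρd : ∀ x ∈ τ, DifferentiableAt ℝ ρ x := fun x hx =>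
    differentiableAt_modulus (hdiff x hx).1 (hdiff x hx).2 (hreg x hx).1.ne'
  have hρ0 : ∀ x ∈ τ, 0 < ρ x := fun x hx => Real.sqrt_pos.2 (hreg x hx).1
  have hρ_lt : ∀ x ∈ Tl, ρ x < 1 := fun x hx => by
    have h1 : ρ2 x < 1 := by have := hx.2; simp only [hg_def] at this; linarith
    have := Real.sqrt_lt_sqrt (hreg x hx.1).1.le h1
    simpa [hρ_def, hρ2_def] using this
  have hρ_eq : ∀ x ∈ Te, ρ x = 1 := fun x hx => by
    have h1 : ρ2 x = 1 := by have := hx.2; simp only [hg_def] at this; linarith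
    simp only [hρ_def]
    simp only [hρ2_def] at h1
    rw [h1, Real.sqrt_one]
  -- cylinders and the cut of `r`
  set Cl : Set (Fin (n + 2) → ℝ) := {w | (fun i : Fin n => w (Fin.castAdd 2 i)) ∈ Tl} with hCl_def
  set Ce : Set (Fin (n + 2) → ℝ) := {w | (fun i : Fin n => w (Fin.castAdd 2 i)) ∈ Te} with hCe_def
  have hCl : IsSemialgebraic ℚ Cl := isSemialgebraic_cyl2 hTl
  have hCe : IsSemialgebraic ℚ Ce := isSemialgebraic_cyl2 hTe
  set rl := r.restrict (r.domain ∩ Cl) (r.isSemialgebraic_domain.inter hCl) inter_subset_left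
    with hrl_def
  set r₁ := r.restrict (r.domain \ Cl) (r.isSemialgebraic_domain.diff hCl) sdiff_subset with hr₁_def
  have e1 : of r - of rl - of r₁ ∈ S := of_sub_restrict_inter_sub_restrict_diff_mem hS r hCl
  set re := r₁.restrict (r₁.domain ∩ Ce) (r₁.isSemialgebraic_domain.inter hCe) inter_subset_left
    with hre_def
  set r₂ := r₁.restrict (r₁.domain \ Ce) (r₁.isSemialgebraic_domain.diff hCe) sdiff_subset with hr₂_def
  have e2 : of r₁ - of re - of r₂ ∈ S := of_sub_restrict_inter_sub_restrict_diff_mem hS r₁ hCe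
  -- the remainder is empty (regime hypothesis)
  have e3 : of r₂ ∈ S := by
    refine of_mem_of_volume_eq_zero hS r₂ (measure_mono_null (fun w hw => ?_) (measure_empty (α := Fin (n + 2) → ℝ)))
    have hw : w ∈ (r.domain \ Cl) \ Ce := hw
    rcases hw with ⟨⟨hwr, hwl⟩, hwe⟩
    rw [hrd] at hwr
    rcases hwr with ⟨hxτ, -⟩
    have h1 : ¬ g (fun i : Fin n => w (Fin.castAdd 2 i)) < 0 := fun h' => hwl ⟨hxτ, h'⟩
    have h2 : ¬ g (fun i : Fin n => w (Fin.castAdd 2 i)) = 0 := fun h' => hwe ⟨hxτ, h'⟩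
    have h3 := (hreg _ hxτ).2
    simp only [hg_def, hρ2_def] at h1 h2 h3
    exact (lt_irrefl (1 : ℝ)) (by
      rcases lt_trichotomy (α₁ (fun i : Fin n => w (Fin.castAdd 2 i)) ^ 2 +
        α₂ (fun i : Fin n => w (Fin.castAdd 2 i)) ^ 2 - 1) 0 with hlt | heq | hgt
      · exact absurd hlt h1
      · exact absurd heq h2
      · linarith)
  -- piece `|α| < 1`: rotate, then Jensen inside
  have hdl : rl.domain = {w | (fun i : Fin n => w (Fin.castAdd 2 i)) ∈ Tl ∧ ((1 < w (Fin.natAdd n 1) ∧ w (Fin.natAdd n 1) < (((1 - w (Fin.natAdd n 0) ^ 2) / (1 + w (Fin.natAdd n 0) ^ 2) - α₁ (fun i : Fin n => w (Fin.castAdd 2 i))) ^ 2 + (2 * w (Fin.natAdd n 0) / (1 + w (Fin.natAdd n 0) ^ 2) - α₂ (fun i : Fin n => w (Fin.castAdd 2 i))) ^ 2)) ∨ ((((1 - w (Fin.natAdd n 0) ^ 2) / (1 + w (Fin.natAdd n 0) ^ 2) - α₁ (fun i : Fin n => w (Fin.castAdd 2 i))) ^ 2 + (2 * w (Fin.natAdd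 n 0) / (1 + w (Fin.natAdd n 0) ^ 2) - α₂ (fun i : Fin n => w (Fin.castAdd 2 i))) ^ 2) < w (Fin.natAdd n 1) ∧ w (Fin.natAdd n 1) < 1))} := by
    show r.domain ∩ Cl = _
    ext w
    rw [hrd]
    simp only [mem_inter_iff, mem_setOf_eq, hCl_def]
    constructor
    · rintro ⟨⟨-, hf⟩, hx⟩; exact ⟨hx, hf⟩
    · rintro ⟨hx, hf⟩; exact ⟨⟨hTlτ hx, hf⟩, hx⟩
  have hil : ∀ w ∈ rl.domain, rl.integrand w = (if 1 < w (Fin.natAdd n 1) then (1:ℝ) else -1) * h (fun i : Fin n => w (Fin.castAdd 2 i)) / ((1 + w (Fin.natAdd n 0) ^ 2) * w (Fin.natAdd n 1)) :=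
    fun w hw' => hri w hw'.1
  have e4 : of rl ∈ S := by
    obtain ⟨R', hR'd, hR'i, e⟩ := hrot n Tl h α₁ α₂ rl hTl (hh.mono hTlτ hTl) (hα₁.mono hTlτ hTl)
      (hα₂.mono hTlτ hTl) (fun x hx => hdiff x hx.1) (fun x hx => (hreg x hx.1).1.ne') hdl hil
    obtain ⟨hhi, hhlog⟩ := hw n Tl h α₁ α₂ hTl (hh.mono hTlτ hTl) (hα₁.mono hTlτ hTl)
      (hα₂.mono hTlτ hTl) (hint.mono_set hTlτ)
    have ein : of R' ∈ S :=
      jensen_inside hS (B := Tl) (h := h) (ρ := ρ) hTl (hh.mono hTlτ hTl)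
        (hρs hTlτ hTl) (fun x hx => hρ0 x hx.1) hρ_lt (fun x hx => hρd x hx.1) hhi hhlog R' hR'd
        (by rw [hR'i]; exact fun _ _ => rfl)
    have : of rl = (of rl - of R') + of R' := by abel
    rw [this]
    exact S.add_mem e ein
  -- piece `|α| = 1`: rotate, then Jensen on the circle
  have hde : re.domain = {w | (fun i : Fin n => w (Fin.castAdd 2 i)) ∈ Te ∧ ((1 < w (Fin.natAdd n 1) ∧ w (Fin.natAdd n 1) < (((1 - w (Fin.natAdd n 0) ^ 2) / (1 + w (Fin.natAdd n 0) ^ 2) - α₁ (fun i : Fin n => w (Fin.castAdd 2 i))) ^ 2 + (2 * w (Fin.natAdd n 0) / (1 + w (Fin.natAdd n 0) ^ 2) - α₂ (fun i : Fin n => w (Fin.castAdd 2 i))) ^ 2)) ∨ ((((1 - w (Fin.natAdd n 0) ^ 2) / (1 + w (Fin.natAdd n 0) ^ 2) - α₁ (fun i : Fin n => w (Fin.castAdd 2 i))) ^ 2 + (2 * w (Fin.natAdd n 0) / (1 + w (Fin.natAdd n 0) ^ 2) - α₂ (fun i : Fin n => w (Fin.castAdd 2 i))) ^ 2) < w (Fin.natAdd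 n 1) ∧ w (Fin.natAdd n 1) < 1))} := by
    show (r.domain \ Cl) ∩ Ce = _
    ext w
    rw [hrd]
    simp only [mem_inter_iff, mem_sdiff, mem_setOf_eq, hCl_def, hCe_def]
    constructor
    · rintro ⟨⟨⟨-, hf⟩, -⟩, hx⟩; exact ⟨hx, hf⟩
    · rintro ⟨hx, hf⟩
      refine ⟨⟨⟨hTeτ hx, hf⟩, fun hxl => ?_⟩, hx⟩
      have h1 := hxl.2; have h2 := hx.2
      rw [h2] at h1; exact lt_irrefl _ h1
  have hie : ∀ w ∈ re.domain, re.integrand w = (if 1 < w (Fin.natAdd n 1) then (1:ℝ) else -1) * h (fun i : Fin n => w (Fin.castAdd 2 i)) / ((1 + w (Fin.natAdd n 0) ^ 2) * w (Fin.natAdd n 1)) :=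
    fun w hw' => hri w hw'.1.1
  have e5 : of re ∈ S := by
    obtain ⟨R', hR'd, hR'i, e⟩ := hrot n Te h α₁ α₂ re hTe (hh.mono hTeτ hTe) (hα₁.mono hTeτ hTe)
      (hα₂.mono hTeτ hTe) (fun x hx => hdiff x hx.1) (fun x hx => (hreg x hx.1).1.ne') hde hie
    obtain ⟨hhi, -⟩ := hw n Te h α₁ α₂ hTe (hh.mono hTeτ hTe) (hα₁.mono hTeτ hTe)
      (hα₂.mono hTeτ hTe) (hint.mono_set hTeτ)
    have ein : of R' ∈ S :=
      jensen_circle hS (B := Te) (h := h) (ρ := ρ) hTe (hh.mono hTeτ hTe)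
        (hρs hTeτ hTe) hρ_eq (fun x hx => hρd x hx.1) hhi R' hR'd
        (by rw [hR'i]; exact fun _ _ => rfl)
    have : of re = (of re - of R') + of R' := by abel
    rw [this]
    exact S.add_mem e ein
  -- sum up
  have : of r = (of r - of rl - of r₁) + (of r₁ - of re - of r₂) + of r₂ + of rl + of re := by abel
  rw [this]
  exact S.add_mem (S.add_mem (S.add_mem (S.add_mem e1 e2) e3) e4) e5

end JensenMoveDiscProof

open JensenMoveDiscProof JensenMoveSplitGlue in
/-- **`JensenMoveDisc`** (route K2SymbolChains, stmt-KontsevichZagierPeriods-17759): over a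
`ℚ`-semialgebraic base with semialgebraic weight `h` and smooth centre `α`, `0 < |α|² ≤ 1`,
`h (1 + |log|α|²|) ∈ L¹`, the unfolded torus representation of `∫ h · J(α)` is a KZ relation.
Proof: `jensenMoveDisc_mem` for `S = KZ.relations` (rotation to a real centre, base cut
`{|α| < 1} ∪ {|α| = 1}`, Jensen inside by doubling + radial constancy, Jensen on the circle by
doubling alone). [Jensen 1899; Kontsevich–Zagier 2001, §1.2, rules 1)–2)] [folklore] -/
theorem jensenMoveDisc_proof :
    Summit.KontsevichZagierPeriods.KontsevichZagierPeriods.Theses.K2SymbolChains.JensenMoveDisc :=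
  jensenMoveDisc_mem scissors_subset_relations

end Summit.KontsevichZagierPeriods.K2SymbolChains
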